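import Summits.QuantumFields.BalabanUV.Beta.GAN24.ScalarSupLettersCubic
import Summits.QuantumFields.BalabanUV.Beta.GAN24.ScalarSup110G

/-!
# G-an2-4 ∕ (CONV-C) — INTERFACE REQUEST G-an2-4 (SCALAR-LETTERS for `Gps`, CUBIC): the four sup → sup letters (L1)–(L4) for NE2's
# scalar averaged propagator `𝒢′ = (Δ + a′Π′)⁻¹` on every cubic unit torus, every `n ≥ 1`, every `a′ > 0` — UNCONDITIONAL
# (the (α) chain's junction `ScalarSupLettersCubic` composed with leaf-01 gen 55's zeroth-order block rows `ScalarSup110G.gps_block_row_sum_le`)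

G-an2-4 formalisation swarm `b2b-balaban-gan24-formalise-*`, leaf prover 06 (gen 35), crux team (2) under the coordinator ruling
«YM REDIRECT» (e34b3e0c).  `ScalarSupLettersCubic.scalarLetters_cubic_of_blockRows` gives the requester's four letters
(`GAN24/SoftMinimiserOneStepSup.norm_Msoft_succ_sub_stair_le_of_letters`: `hB₂` (L1) `G′∇*`, `hC₁` (L2) `∇G′`, `hB₁` (L3) `G′∇*∇*`,
`hC₂` (L4) `∇*∇G′`) from the displayed zeroth-order block rows (L0); leaf-01 gen 55's `ScalarSup110G.gps_block_row_sum_le` PROVES (L0)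
for every `n ≥ 1`, every torus and every `a′ > 0`.  THIS FILE is the ten-line composition:
 * **`scalarLetters_cubic`** — `∀ a′ > 0, ∃ Cst > 0, ∀ n N₀ ≥ 1, ∀ μ ν g b, ‖g‖_∞ ≤ b → ∀ x,` the four bounds
   `‖(𝒢′∂_νᴴ g)(x)‖ ≤ Cst·b`, `‖(𝒢′∂_μᴴ∂_νᴴ g)(x)‖ ≤ Cst·(1 + log n)·b`, `‖(∂_ν𝒢′ g)(x)‖ ≤ Cst·b`, `‖(∂_μᴴ∂_ν𝒢′ g)(x)‖ ≤ Cst·(1 + log n)·b`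
   on the cubic torus `fun _ : Fin (d+1) ⇒ N₀`, NO HYPOTHESIS left;
 * **`scalarRowDecay_cubic`** — the (SCALAR-LETTERS-LOC) export (per-block ROW-DECAY form, road P2's `RowDecay` bodies), NO HYPOTHESIS;
 * the four letters singly: **`scalarSup_GDiv`** (L1), **`scalarSup_DivG`** (L2), **`scalarSup_GDivDiv`** (L3), **`scalarSup_DivDivG`** (L4).

HONEST SCOPE.  Composition only; the mathematics is the (α) chain (`FlatResolventPieces`∕`FlatResolventStep`∕`ScalarFlatLift`∕
`ScalarFlatDictionary`∕`ScalarFlatResolvent`, this lineage; free heat-kernel input leaf-03 gen 48's (A)–(C); resummation leaf-04 gen 47's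
`ScalarSupReductions`) and leaf-01 gen 55's `ScalarSup110G` chain.  [folklore] lattice analysis of the cell's typed `U = 1` objects;
constants existential in `(d, a′)`; no `def`, no `def … : Prop`, no `sorry`.  Bałaban prints (1.110)∕(1.112)∕(1.115) for the VECTOR `G`
([B5] pp. 35–36) and [B9] (3.42) for the covariant scalar operator at general `U` — the `U = 1` cubic-torus sup → sup letters with
`1 + log n` are OURS, not a quotation.  NOT (CONV-C), NEVER «G-an2-4 closed», NOT NE2 ∕ NE3, NOT D1, NOT BetaPertH, NOT continuum, NOT
Clay; not in print — our bookkeeping.  ABSOLUTE RULE of the cell kept.  HONEST DEPENDENCY: continuum YM on T⁴ ⇐ BetaPertH ∧ nine spine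
estimates (0/9 proved); BetaPertH ⇐ (D1) ∧ (D4) ∧ CAP+tail; G-an2-4 gates asym, D1 and NE2/3/4.
-/

noncomputable section

open scoped BigOperators ComplexConjugate Matrix
open Finset

namespace Summit.QuantumFields.BalabanUV.Beta.GAN24.ScalarSupLettersCubicHolds

open Literature.MathematicalPhysics.QuantumFieldTheory.Balaban1983to89
open Literature.MathematicalPhysics.QuantumFieldTheory.Balaban1983to89.B5Prop11Plancherel (Tor fine)
open Literature.MathematicalPhysics.QuantumFieldTheory.Balaban1983to89.B5Action121 (sdiff)
open Literature.MathematicalPhysics.QuantumFieldTheory.Balaban1983to89.B5Blocks16 (blockOf)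
open Literature.MathematicalPhysics.QuantumFieldTheory.Balaban1983to89.B6LowerBound2153Torus (rep)
open Literature.MathematicalPhysics.QuantumFieldTheory.Balaban1983to89.B4TorusKernel.MultiPeriod (torusSupNorm)
open Summit.QuantumFields.BalabanUV.T4Continuum.ScalarAveragedPropagator (Gps)
open Summit.QuantumFields.BalabanUV.Beta.GAN24.ScalarSupLettersCubic (scalarLetters_cubic_of_blockRows scalarRowDecay_cubic_of_blockRows)
open Summit.QuantumFields.BalabanUV.Beta.GAN24.ScalarSup110G (gps_block_row_sum_le)

variable (d : ℕ)

/-- **THE FOUR SCALAR SUP → SUP LETTERS ON CUBIC TORI — UNCONDITIONAL.**  For every `a′ > 0` there is `Cst > 0` (a function of `d, a′`)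
such that for every `n, N₀ ≥ 1`, all directions `μ, ν`, every `g` with `‖g‖_∞ ≤ b` and every site `x` of the fine torus over the cubic unit
torus `Π_μ ℤ/N₀`: `‖(𝒢′∂_νᴴ g)(x)‖ ≤ Cst·b`, `‖(𝒢′∂_μᴴ∂_νᴴ g)(x)‖ ≤ Cst·(1 + log n)·b`, `‖(∂_ν𝒢′ g)(x)‖ ≤ Cst·b`,
`‖(∂_μᴴ∂_ν𝒢′ g)(x)‖ ≤ Cst·(1 + log n)·b` (`𝒢′ = Gps n (fun _ ⇒ N₀) a′`, `∂_ν = sdiff (fine n _) n ν`). [folklore] -/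
theorem scalarLetters_cubic {a' : ℝ} (ha' : 0 < a') :
    ∃ Cst : ℝ, 0 < Cst ∧ ∀ (n N₀ : ℕ) [NeZero n] [NeZero N₀], 1 ≤ n →
      ∀ (μ ν : Fin (d + 1)) (g : Tor (fine n (fun _ : Fin (d + 1) => N₀)) → ℂ) (b : ℝ), (∀ y, ‖g y‖ ≤ b) →
        ∀ x : Tor (fine n (fun _ : Fin (d + 1) => N₀)),
          ‖(Gps n (fun _ : Fin (d + 1) => N₀) a' *ᵥ
              ((sdiff (fine n (fun _ : Fin (d + 1) => N₀)) (n : ℂ) ν)ᴴ *ᵥ g)) x‖ ≤ Cst * b ∧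
          ‖(Gps n (fun _ : Fin (d + 1) => N₀) a' *ᵥ
              ((sdiff (fine n (fun _ : Fin (d + 1) => N₀)) (n : ℂ) μ)ᴴ *ᵥ
                ((sdiff (fine n (fun _ : Fin (d + 1) => N₀)) (n : ℂ) ν)ᴴ *ᵥ g))) x‖ ≤ Cst * (1 + Real.log n) * b ∧
          ‖(sdiff (fine n (fun _ : Fin (d + 1) => N₀)) (n : ℂ) ν *ᵥ (Gps n (fun _ : Fin (d + 1) => N₀) a' *ᵥ g)) x‖ ≤ Cst * b ∧
          ‖((sdiff (fine n (fun _ : Fin (d + 1) => N₀)) (n : ℂ) μ)ᴴ *ᵥ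
              (sdiff (fine n (fun _ : Fin (d + 1) => N₀)) (n : ℂ) ν *ᵥ (Gps n (fun _ : Fin (d + 1) => N₀) a' *ᵥ g))) x‖
            ≤ Cst * (1 + Real.log n) * b := by
  obtain ⟨δ₀, C, hδ₀, hC, h⟩ := gps_block_row_sum_le d ha'
  exact scalarLetters_cubic_of_blockRows d ha' hC.le hδ₀ (fun n N₀ _ _ x x' r => h n (fun _ => N₀) x x' r)

/-- **(SCALAR-LETTERS-LOC), UNCONDITIONAL — the four letters in per-block ROW-DECAY form on cubic tori** (the bodies of road P2's
`BlockFieldDecay.RowDecay (fun _ ⇒ N₀) (blockOf n _) (blockOf n _) K C δ`, `Iff.rfl` away): `∀ a′ > 0, ∃ Cst δ > 0, ∀ n N₀ ≥ 1, ∀ μ ν x y′,`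
`Σ_{x′ ∈ B(y′)} ‖K(x,x′)‖ ≤ Cst·[1 + log n]·e^{−δ·|rep(blk x) − rep y′|_{T₁,∞}}` for `K = 𝒢′∂_νᴴ`, `𝒢′∂_μᴴ∂_νᴴ` (log), `∂_ν𝒢′`, `∂_μᴴ∂_ν𝒢′` (log).
[folklore] -/
theorem scalarRowDecay_cubic {a' : ℝ} (ha' : 0 < a') :
    ∃ Cst δ : ℝ, 0 < Cst ∧ 0 < δ ∧ ∀ (n N₀ : ℕ) [NeZero n] [NeZero N₀], 1 ≤ n →
      ∀ (μ ν : Fin (d + 1)) (x : Tor (fine n (fun _ : Fin (d + 1) => N₀))) (y' : Tor (fun _ : Fin (d + 1) => N₀)),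
        (∑ x' : Tor (fine n (fun _ : Fin (d + 1) => N₀)),
            (if blockOf n (fun _ : Fin (d + 1) => N₀) x' = y' then
              ‖(Gps n (fun _ : Fin (d + 1) => N₀) a' * (sdiff (fine n (fun _ : Fin (d + 1) => N₀)) (n : ℂ) ν)ᴴ) x x'‖ else 0)
          ≤ Cst * Real.exp (-(δ * torusSupNorm (fun _ : Fin (d + 1) => N₀)
              (rep (fun _ : Fin (d + 1) => N₀) (blockOf n (fun _ : Fin (d + 1) => N₀) x) - rep (fun _ : Fin (d + 1) => N₀) y')))) ∧
        (∑ x' : Tor (fine n (fun _ : Fin (d + 1) => N₀)),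
            (if blockOf n (fun _ : Fin (d + 1) => N₀) x' = y' then
              ‖(Gps n (fun _ : Fin (d + 1) => N₀) a' * (sdiff (fine n (fun _ : Fin (d + 1) => N₀)) (n : ℂ) μ)ᴴ
                  * (sdiff (fine n (fun _ : Fin (d + 1) => N₀)) (n : ℂ) ν)ᴴ) x x'‖ else 0)
          ≤ Cst * (1 + Real.log n) * Real.exp (-(δ * torusSupNorm (fun _ : Fin (d + 1) => N₀)
              (rep (fun _ : Fin (d + 1) => N₀) (blockOf n (fun _ : Fin (d + 1) => N₀) x) - rep (fun _ : Fin (d + 1) => N₀) y')))) ∧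
        (∑ x' : Tor (fine n (fun _ : Fin (d + 1) => N₀)),
            (if blockOf n (fun _ : Fin (d + 1) => N₀) x' = y' then
              ‖(sdiff (fine n (fun _ : Fin (d + 1) => N₀)) (n : ℂ) ν * Gps n (fun _ : Fin (d + 1) => N₀) a') x x'‖ else 0)
          ≤ Cst * Real.exp (-(δ * torusSupNorm (fun _ : Fin (d + 1) => N₀)
              (rep (fun _ : Fin (d + 1) => N₀) (blockOf n (fun _ : Fin (d + 1) => N₀) x) - rep (fun _ : Fin (d + 1) => N₀) y')))) ∧
        (∑ x' : Tor (fine n (fun _ : Fin (d + 1) => N₀)),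
            (if blockOf n (fun _ : Fin (d + 1) => N₀) x' = y' then
              ‖((sdiff (fine n (fun _ : Fin (d + 1) => N₀)) (n : ℂ) μ)ᴴ * sdiff (fine n (fun _ : Fin (d + 1) => N₀)) (n : ℂ) ν
                  * Gps n (fun _ : Fin (d + 1) => N₀) a') x x'‖ else 0)
          ≤ Cst * (1 + Real.log n) * Real.exp (-(δ * torusSupNorm (fun _ : Fin (d + 1) => N₀)
              (rep (fun _ : Fin (d + 1) => N₀) (blockOf n (fun _ : Fin (d + 1) => N₀) x) - rep (fun _ : Fin (d + 1) => N₀) y')))) := by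
  obtain ⟨δ₀, C, hδ₀, hC, h⟩ := gps_block_row_sum_le d ha'
  exact scalarRowDecay_cubic_of_blockRows d ha' hC.le hδ₀ (fun n N₀ _ _ x x' r => h n (fun _ => N₀) x x' r)

variable {d}

/-- **(L1) `G′∇*`, UNCONDITIONAL** (the requester's binder `hB₂`, with `∃ C` in front): `‖(𝒢′∂_νᴴ g)(x)‖ ≤ C·b` on cubic tori. [folklore] -/
theorem scalarSup_GDiv {a' : ℝ} (ha' : 0 < a') :
    ∃ Cst : ℝ, 0 < Cst ∧ ∀ (n N₀ : ℕ) [NeZero n] [NeZero N₀], 1 ≤ n →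
      ∀ (ν : Fin (d + 1)) (g : Tor (fine n (fun _ : Fin (d + 1) => N₀)) → ℂ) (b : ℝ), (∀ y, ‖g y‖ ≤ b) →
        ∀ x, ‖(Gps n (fun _ : Fin (d + 1) => N₀) a' *ᵥ ((sdiff (fine n (fun _ : Fin (d + 1) => N₀)) (n : ℂ) ν)ᴴ *ᵥ g)) x‖
          ≤ Cst * b := by
  obtain ⟨Cst, hCst, h⟩ := scalarLetters_cubic d ha'
  exact ⟨Cst, hCst, fun n N₀ _ _ hn ν g b hg x => (h n N₀ hn ν ν g b hg x).1⟩

/-- **(L2) `∇G′`, UNCONDITIONAL** (binder `hC₁`): `‖(∂_ν𝒢′ g)(x)‖ ≤ C·b` on cubic tori. [folklore] -/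
theorem scalarSup_DivG {a' : ℝ} (ha' : 0 < a') :
    ∃ Cst : ℝ, 0 < Cst ∧ ∀ (n N₀ : ℕ) [NeZero n] [NeZero N₀], 1 ≤ n →
      ∀ (ν : Fin (d + 1)) (g : Tor (fine n (fun _ : Fin (d + 1) => N₀)) → ℂ) (b : ℝ), (∀ y, ‖g y‖ ≤ b) →
        ∀ x, ‖(sdiff (fine n (fun _ : Fin (d + 1) => N₀)) (n : ℂ) ν *ᵥ (Gps n (fun _ : Fin (d + 1) => N₀) a' *ᵥ g)) x‖
          ≤ Cst * b := by
  obtain ⟨Cst, hCst, h⟩ := scalarLetters_cubic d ha'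
  exact ⟨Cst, hCst, fun n N₀ _ _ hn ν g b hg x => (h n N₀ hn ν ν g b hg x).2.2.1⟩

/-- **(L3) `G′∇*∇*`, UNCONDITIONAL** (binder `hB₁`, there with `μ = ν`; here all pairs): `‖(𝒢′∂_μᴴ∂_νᴴ g)(x)‖ ≤ C·(1 + log n)·b` on
cubic tori. [folklore] -/
theorem scalarSup_GDivDiv {a' : ℝ} (ha' : 0 < a') :
    ∃ Cst : ℝ, 0 < Cst ∧ ∀ (n N₀ : ℕ) [NeZero n] [NeZero N₀], 1 ≤ n →
      ∀ (μ ν : Fin (d + 1)) (g : Tor (fine n (fun _ : Fin (d + 1) => N₀)) → ℂ) (b : ℝ), (∀ y, ‖g y‖ ≤ b) →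
        ∀ x, ‖(Gps n (fun _ : Fin (d + 1) => N₀) a' *ᵥ
              ((sdiff (fine n (fun _ : Fin (d + 1) => N₀)) (n : ℂ) μ)ᴴ *ᵥ
                ((sdiff (fine n (fun _ : Fin (d + 1) => N₀)) (n : ℂ) ν)ᴴ *ᵥ g))) x‖ ≤ Cst * (1 + Real.log n) * b := by
  obtain ⟨Cst, hCst, h⟩ := scalarLetters_cubic d ha'
  exact ⟨Cst, hCst, fun n N₀ _ _ hn μ ν g b hg x => (h n N₀ hn μ ν g b hg x).2.1⟩

/-- **(L4) `∇*∇G′`, UNCONDITIONAL** (binder `hC₂`, there with `μ = ν`; here all pairs): `‖(∂_μᴴ∂_ν𝒢′ g)(x)‖ ≤ C·(1 + log n)·b` on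
cubic tori. [folklore] -/
theorem scalarSup_DivDivG {a' : ℝ} (ha' : 0 < a') :
    ∃ Cst : ℝ, 0 < Cst ∧ ∀ (n N₀ : ℕ) [NeZero n] [NeZero N₀], 1 ≤ n →
      ∀ (μ ν : Fin (d + 1)) (g : Tor (fine n (fun _ : Fin (d + 1) => N₀)) → ℂ) (b : ℝ), (∀ y, ‖g y‖ ≤ b) →
        ∀ x, ‖((sdiff (fine n (fun _ : Fin (d + 1) => N₀)) (n : ℂ) μ)ᴴ *ᵥ
              (sdiff (fine n (fun _ : Fin (d + 1) => N₀)) (n : ℂ) ν *ᵥ (Gps n (fun _ : Fin (d + 1) => N₀) a' *ᵥ g))) x‖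
          ≤ Cst * (1 + Real.log n) * b := by
  obtain ⟨Cst, hCst, h⟩ := scalarLetters_cubic d ha'
  exact ⟨Cst, hCst, fun n N₀ _ _ hn μ ν g b hg x => (h n N₀ hn μ ν g b hg x).2.2.2⟩

end Summit.QuantumFields.BalabanUV.Beta.GAN24.ScalarSupLettersCubicHolds
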